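import Summits.ResolutionOfSingularities.ResolutionOfSingularities.Theorems.FrobeniusLadderFInjectiveMacaulayficationGermOfGlobalBlowup
import Literature.AlgebraicGeometry.Resolution.CohenMacaulaySystemsOfParameters
import Literature.AlgebraicGeometry.Resolution.CohenMacaulayCatenary
import Literature.AlgebraicGeometry.Resolution.RegularLocalRingsQuotient
import Mathlib.RingTheory.Flat.Localization
import Mathlib.RingTheory.Flat.TorsionFree
import Mathlib.RingTheory.Regular.Flat
import Mathlib.RingTheory.Ideal.GoingUp
import Mathlib.RingTheory.Ideal.Height
import Mathlib.RingTheory.RegularLocalRing.Polynomial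
import HarnessLib

/-!
# Generic engine: a Noetherian algebra FLAT and INTEGRAL over a regular ring is Cohen–Macaulay at every prime
# (crux `FInjectiveMacaulayfication` stmt-ResolutionOfSingularities-15315, chain w45a; res-L1-w45a-plan-1 R18.32 «(N1) ROW #2 TWO-SIDED → stub-3»;
# seat res-L1-w45a-stub-3 g10)

[OURS · L1 W4.5a] Support file (`--supports stmt-ResolutionOfSingularities-15315 --as helper`); replaces the role of NO printed item; NOT a statement of
any manuscript; def-free; UNCONDITIONAL; generic (no specimen). AI-written (AI review is weaker than expert review).

WHY. Every Rees chart of the τ-floors met so far (P2d4C, P2d4F5, …; res-L1-w45a-idea-1 `fb5r4/tau/*.json`) is a complete intersection of the special shape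
«iterated MONIC monogenic extension of a polynomial ring» (`y² = x·W₀`, `u² = x·W₁`, …): a finite FREE algebra over a polynomial ring. For such algebras the CM
clause at every prime needs no regular-sequence bookkeeping chart by chart:
* §1 `ringKrullDim_atPrime_le_of_isIntegral` — INCOMPARABILITY: for `B` integral over `A` and a prime `P` of `B`, `dim B_P ≤ dim A_{P ∩ A}` (contraction of
  primes is strictly monotone, Matsumura 9.3 (ii)).
* §2 ★ `exists_isRegular_of_flat_of_isIntegral` — for `B` Noetherian, FLAT and INTEGRAL over `A`, and `P` a prime of `B` such that `A_{P ∩ A}` carries a regular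
  sequence in its maximal ideal of length `dim A_{P ∩ A}`: `B_P` carries a regular sequence in its maximal ideal of length `dim B_P` (the image of the former is
  weakly regular by flatness of `A_{P∩A} → B_P` — Mathlib `IsWeaklyRegular.of_flat` — lies in the maximal ideal, and may be truncated to length `dim B_P ≤ dim A_{P∩A}`).
* §3 ★★ `cmCl_localization_of_flat_of_isIntegral` (clause form, base CM at every prime) and ★★ `cmCl_localization_of_isRegularRing` (base a regular ring, e.g.
  `k[X₁..X_n]`): `CMCl (B_P)` for every prime `P`; stalk form `cmCl_stalk_Spec_of_isRegularRing`.
* §4 `mem_nonZeroDivisors_algebraMap_of_flat` — over a FLAT algebra a non-zero-divisor of the base stays a non-zero-divisor (torsion-freeness; used for the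
  injectivity `C → C[1/x]` of the chart identifications).
[cite: Matsumura1987, Thm. 9.3 (ii), Thm. 17.3 (iii), Thm. 17.4 (iii), Thm. 23.3 (context: flat local homomorphisms with CM fibres)] [cite: BrunsHerzog1998, Thm. 2.1.2,
Prop. 1.1.1 ff.]
-/

-- single-problem summit: the doubled namespace component is forced
set_option linter.dupNamespace false

noncomputable section

namespace Summit.ResolutionOfSingularities.ResolutionOfSingularities.Theorems.FInjectiveMacaulayfication.FlatIntegralCM

open IsLocalRing RingTheory.Sequence Literature.AlgebraicGeometry.Resolution
open Summit.ResolutionOfSingularities.ResolutionOfSingularities.Theorems.FInjectiveMacaulayfication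
open SliceableCentre

universe u v

/-! ## §1 Incomparability: `dim B_P ≤ dim A_{P ∩ A}` -/

/-- **Incomparability, local form**: for `B` integral over `A` and a prime `P` of `B`, `ht P ≤ ht (P ∩ A)`. [cite: Matsumura1987, Thm. 9.3 (ii)] -/
theorem height_le_height_under_of_isIntegral {A : Type u} {B : Type v} [CommRing A] [CommRing B] [Algebra A B] [Algebra.IsIntegral A B]
    (P : Ideal B) [P.IsPrime] : P.height ≤ (P.under A).height := by
  have h1 : P.height = Order.height (⟨P, inferInstance⟩ : PrimeSpectrum B) := PrimeSpectrum.height_eq_orderHeight ⟨P, inferInstance⟩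
  have h2 : (P.under A).height = Order.height (⟨P.under A, inferInstance⟩ : PrimeSpectrum A) :=
    PrimeSpectrum.height_eq_orderHeight ⟨P.under A, inferInstance⟩
  rw [h1, h2]
  exact Order.height_le_height_apply_of_strictMono (fun Q : PrimeSpectrum B => PrimeSpectrum.comap (algebraMap A B) Q)
    (fun _ _ h => Ideal.IsIntegral.comap_lt_comap h) ⟨P, inferInstance⟩

/-- **Incomparability, dimension form**: `dim B_P ≤ dim A_{P ∩ A}` for `B` integral over `A`. [cite: Matsumura1987, Thm. 9.3 (ii)] -/
theorem ringKrullDim_atPrime_le_of_isIntegral {A : Type u} {B : Type v} [CommRing A] [CommRing B] [Algebra A B] [Algebra.IsIntegral A B]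
    (P : Ideal B) [P.IsPrime] : ringKrullDim (Localization.AtPrime P) ≤ ringKrullDim (Localization.AtPrime (P.under A)) := by
  rw [IsLocalization.AtPrime.ringKrullDim_eq_height P (Localization.AtPrime P),
    IsLocalization.AtPrime.ringKrullDim_eq_height (P.under A) (Localization.AtPrime (P.under A))]
  exact_mod_cast height_le_height_under_of_isIntegral P

/-! ## §2 Regular sequences ascend along flat integral extensions -/

/-- **A weakly regular sequence may be truncated**: the first `m` terms of a weakly regular sequence form a weakly regular sequence. [folklore] -/
theorem isWeaklyRegular_take {R : Type u} [CommRing R] {rs : List R} (h : IsWeaklyRegular R rs) (m : ℕ) : IsWeaklyRegular R (rs.take m) := by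
  rw [← List.take_append_drop m rs] at h
  exact ((isWeaklyRegular_append_iff R (rs.take m) (rs.drop m)).mp h).1

/-- ★ **Regular sequences ASCEND along flat integral extensions.** `B` Noetherian, FLAT and INTEGRAL over `A`, `P` a prime of `B`, `p = P ∩ A`; if `A_p` has a regular
sequence in its maximal ideal of length `dim A_p`, then `B_P` has one of length `dim B_P`: map it along the flat local homomorphism `A_p → B_P`
(`IsWeaklyRegular.of_flat`), truncate to `dim B_P ≤ dim A_p` (§1). [cite: Matsumura1987, Thm. 23.3 (context); Thm. 9.3 (ii)] -/
theorem exists_isRegular_of_flat_of_isIntegral {A : Type u} {B : Type u} [CommRing A] [CommRing B] [Algebra A B] [IsNoetherianRing B] [Module.Flat A B]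
    [Algebra.IsIntegral A B] (P : Ideal B) [P.IsPrime]
    (hA : ∃ rs : List (Localization.AtPrime (P.under A)), IsRegular (Localization.AtPrime (P.under A)) rs ∧
      (∀ r ∈ rs, r ∈ maximalIdeal (Localization.AtPrime (P.under A))) ∧ (rs.length : WithBot ℕ∞) = ringKrullDim (Localization.AtPrime (P.under A))) :
    ∃ rs : List (Localization.AtPrime P), IsRegular (Localization.AtPrime P) rs ∧ (∀ r ∈ rs, r ∈ maximalIdeal (Localization.AtPrime P)) ∧
      (rs.length : WithBot ℕ∞) = ringKrullDim (Localization.AtPrime P) := by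
  letI : Algebra (Localization.AtPrime (P.under A)) (Localization.AtPrime P) := Localization.AtPrime.algebraOfLiesOver (P.under A) P
  haveI : IsNoetherianRing (Localization.AtPrime P) := IsLocalization.isNoetherianRing P.primeCompl _ inferInstance
  obtain ⟨rs, hreg, hmem, hlen⟩ := hA
  obtain ⟨m, hm⟩ := exists_nat_cast_eq_ringKrullDim (R := Localization.AtPrime P)
  -- the image sequence is weakly regular (flatness) and lies in the maximal ideal (local homomorphism)
  have hw : IsWeaklyRegular (Localization.AtPrime P) (rs.map (algebraMap _ _)) := hreg.toIsWeaklyRegular.of_flat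
  have hmem' : ∀ r ∈ rs.map (algebraMap (Localization.AtPrime (P.under A)) (Localization.AtPrime P)), r ∈ maximalIdeal (Localization.AtPrime P) := by
    intro r hr
    obtain ⟨a, ha, rfl⟩ := List.mem_map.mp hr
    rw [Localization.AtPrime.IsLiesOverAlgebra.algebraMap_eq]
    exact map_nonunit (Localization.localRingHom (P.under A) P (algebraMap A B) Ideal.LiesOver.over) a (hmem a ha)
  -- truncate to `m = dim B_P ≤ dim A_p = |rs|`
  have hmle : m ≤ rs.length := by
    have h := ringKrullDim_atPrime_le_of_isIntegral (A := A) P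
    rw [hm, ← hlen] at h
    exact_mod_cast h
  refine ⟨(rs.map (algebraMap _ _)).take m, ?_, fun r hr => hmem' r (List.mem_of_mem_take hr), ?_⟩
  · haveI : Nontrivial (Localization.AtPrime P) := inferInstance
    exact (IsLocalRing.isRegular_iff_isWeaklyRegular_of_subset_maximalIdeal (fun r hr => hmem' r (List.mem_of_mem_take hr))).mpr
      (isWeaklyRegular_take hw m)
  · rw [List.length_take, List.length_map, Nat.min_eq_left hmle, hm]

/-! ## §3 The CM clause at every prime -/

/-- ★★ **CM ASCENDS along flat integral extensions (clause form).** `A`, `B` Noetherian, `B` flat and integral over `A`, the CM clause at every prime of `A` ⇒ the CM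
clause at every prime of `B`. [cite: Matsumura1987, Thm. 23.3 (context), Thm. 17.4 (iii)] -/
theorem cmCl_localization_of_flat_of_isIntegral {A B : Type} [CommRing A] [CommRing B] [Algebra A B] [IsNoetherianRing A] [IsNoetherianRing B]
    [Module.Flat A B] [Algebra.IsIntegral A B] (hA : ∀ (p : Ideal A) [p.IsPrime], CMCl (Localization.AtPrime p)) (P : Ideal B) [P.IsPrime] :
    CMCl (Localization.AtPrime P) := by
  haveI : IsNoetherianRing (Localization.AtPrime P) := IsLocalization.isNoetherianRing P.primeCompl _ inferInstance
  haveI : IsNoetherianRing (Localization.AtPrime (P.under A)) := IsLocalization.isNoetherianRing (P.under A).primeCompl _ inferInstance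
  exact cmClause_of_exists_isRegular (exists_isRegular_of_flat_of_isIntegral P (exists_isRegular_of_cmClause (hA (P.under A))))

/-- ★★ **A Noetherian algebra FLAT and INTEGRAL over a REGULAR ring (e.g. finite and free over `k[X₁..X_n]`) satisfies the CM clause at every prime.**
[cite: Matsumura1987, Thm. 17.8, Thm. 23.3 (context)] -/
theorem cmCl_localization_of_isRegularRing {A B : Type} [CommRing A] [CommRing B] [Algebra A B] [IsRegularRing A] [IsNoetherianRing B]
    [Module.Flat A B] [Algebra.IsIntegral A B] (P : Ideal B) [P.IsPrime] : CMCl (Localization.AtPrime P) := by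
  haveI : IsNoetherianRing (Localization.AtPrime P) := IsLocalization.isNoetherianRing P.primeCompl _ inferInstance
  exact cmClause_of_exists_isRegular (exists_isRegular_of_flat_of_isIntegral P
    (exists_isRegular_length_eq_ringKrullDim (Localization.AtPrime (P.under A))))

/-- Stalk form: `Spec B` satisfies the CM clause at every point, for `B` Noetherian, flat and integral over a regular ring. [folklore transport] -/
theorem cmCl_stalk_Spec_of_isRegularRing {A B : Type} [CommRing A] [CommRing B] [Algebra A B] [IsRegularRing A] [IsNoetherianRing B]
    [Module.Flat A B] [Algebra.IsIntegral A B] (w : AlgebraicGeometry.Spec (.of B)) : CMCl ((AlgebraicGeometry.Spec (.of B)).presheaf.stalk w) :=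
  GermOfGlobalBlowup.cmCl_stalk_Spec_of_cmCl_localization w (cmCl_localization_of_isRegularRing (A := A) w.asIdeal)

/-! ## §4 Non-zero-divisors of the base stay non-zero-divisors -/

/-- **Over a flat algebra, a non-zero-divisor of the base is a non-zero-divisor** (flat modules are torsion-free). [cite: Matsumura1987, Thm. 7.6 (context)] -/
theorem mem_nonZeroDivisors_algebraMap_of_flat {A : Type u} {B : Type v} [CommRing A] [CommRing B] [Algebra A B] [Module.Flat A B] {a : A}
    (ha : a ∈ nonZeroDivisors A) : algebraMap A B a ∈ nonZeroDivisors B := by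
  have h : IsSMulRegular B a := Module.Flat.isSMulRegular_of_nonZeroDivisors ha
  rw [mem_nonZeroDivisors_iff_right]
  intro b hb
  apply h
  change a • b = a • (0 : B)
  rw [smul_zero, Algebra.smul_def, mul_comm]
  exact hb

/-- In particular over a domain base: `algebraMap A B a` is a non-zero-divisor for every `a ≠ 0`. [folklore] -/
theorem mem_nonZeroDivisors_algebraMap_of_flat_of_ne_zero {A : Type u} {B : Type v} [CommRing A] [IsDomain A] [CommRing B] [Algebra A B] [Module.Flat A B]
    {a : A} (ha : a ≠ 0) : algebraMap A B a ∈ nonZeroDivisors B :=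
  mem_nonZeroDivisors_algebraMap_of_flat (mem_nonZeroDivisors_of_ne_zero ha)

end Summit.ResolutionOfSingularities.ResolutionOfSingularities.Theorems.FInjectiveMacaulayfication.FlatIntegralCM

end
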